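import Summits.CriticalPhenomena.PercolationContinuityZ3.Theorems.SahiMasterFamilyPointwise
import Summits.CriticalPhenomena.PercolationContinuityZ3.Theorems.SahiMasterFamilyLowerTransfer
import Summits.CriticalPhenomena.PercolationContinuityZ3.Theorems.SahiMasterFamilyLower

/-!
# DECREASING events (the percolation separations): (EQI-k) at every order, open-set zeros, generic parameters — and the GRAPH FORM
# for group separations `D[X|Y]`

Unit `prim-master-conj` (crux anchor stmt-CriticalPhenomena-4575, helper work), gen 13; companion of `SahiMasterFamilyPointwise.lean` (increasing
events).  Seat P4's transfer `SahiMasterFamilyLowerTransfer` (complement the configurations, flip `p ↦ 1 − p`: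
`sahiE_ind_eq_sahiE_ind_preimage_compl`, `suppZeroFlag_preimage_compl_iff`) carries every increasing-side statement to decreasing families:

* `sahiE_ind_lower_identically_zero_iff` — **(EQI-k) for DECREASING events, every order**: for decreasing `D_0,…,D_{k−1}`,
  `E_k(μ_p; 1_D) = 0` for every interior `p` iff `D ∈ Z_k` (from gen 12's `GluedFrames.masterFamilyIdentEqIff_all`);
* `suppZeroFlag_lower_of_eq_zero_on_open`, `sahiE_ind_lower_eq_zero_on_open_iff` — zero on a nonempty OPEN parameter set iff `Z_k`;
* `masterFamily_step_all_lower` — the all-order step for decreasing families (a `Z_{k−1}` deletion ⟹ `E ≥ 0` and pointwise `E = 0 ↔ Z_k`);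
* `isOpen_goodParams_lower`, `dense_goodParams_lower` — the decreasing good parameter set is open and dense;
* **GRAPH FORM** (group separations `{X_j ↮ Y_j}` of a finite weighted graph, cf. `sahiE_groupSep_eq_zero_of_suppZeroFlag` /
  `…_iff_of_masterFamilyEqIffLower` of `SahiMasterFamilyLower`): `sahiE_groupSep_identically_zero_iff` — **`E_k(D[X_0|Y_0],…,D[X_{k−1}|Y_{k−1}]) = 0`
  for all edge weights in the open cube iff the separations form a zero flag** (unconditional, every `k`); `sahiE_groupSep_eq_zero_on_open_iff`
  (zero on an open set of weight vectors iff zero flag); `exists_groupSep_goodWeights_of_isOpen` (every nonempty open set of weight vectors contains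
  one at which `E_k = 0 ↔ Z_k` holds for ALL `k`-tuples of group separations simultaneously).  This is the exact statement behind the cell's
  separation censuses (MASTER-FAMILY §MASTER "GRAPH FORM"; ttrl e4/e5k4): identically / locally / generically vanishing `E_k` rows are the `Z_k` rows.
Nothing here asserts (EQ-k) or `C_k`; axioms standard. [this work]
-/

noncomputable section

open scoped Classical
open scoped unitInterval

namespace Summit.CriticalPhenomena.PercolationContinuityZ3.Theorems

open Finset Function Topology
open Literature.Combinatorics.Sahi2008
open Literature.Probability.LatticeModels (isUpperSet_preimage_compl isLowerSet_preimage_compl)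
open Literature.Probability.Percolation (DeterminedBy)
open Literature.Probability.Percolation.DecisionTree (ind)

namespace Pointwise

variable {ι : Type} [Fintype ι]

/-! ### (EQI-k), open-set zeros and the step for decreasing families -/

/-- **(EQI-k) for decreasing events, every order.** [this work] -/
theorem sahiE_ind_lower_identically_zero_iff {k : ℕ} (D : Fin k → Set (Set ι)) (hD : ∀ j, IsLowerSet (D j)) :
    (∀ p : ι → unitInterval, (∀ e, (p e : ℝ) ∈ Set.Ioo (0 : ℝ) 1) → sahiE (bernoulliWeight p) k (fun j => ind (D j)) = 0) ↔
      SuppZeroFlag k D := by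
  rw [← suppZeroFlag_preimage_compl_iff k D]
  have hU : ∀ j, IsUpperSet (compl ⁻¹' D j) := fun j => isUpperSet_preimage_compl (hD j)
  rw [← GluedFrames.masterFamilyIdentEqIff_all k ι (fun j => compl ⁻¹' D j) hU]
  constructor
  · intro h q hq
    have h1 := h (fun e => σ (q e)) ((symm_mem_Ioo_iff q).2 hq)
    rw [sahiE_ind_eq_sahiE_ind_preimage_compl] at h1
    simpa only [symm_symm_params] using h1
  · intro h p hp
    rw [sahiE_ind_eq_sahiE_ind_preimage_compl]
    exact h _ ((symm_mem_Ioo_iff p).2 hp)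

/-- **Decreasing events: zero on a nonempty open parameter set ⟹ `Z_k`.** [this work] -/
theorem suppZeroFlag_lower_of_eq_zero_on_open {k : ℕ} (D : Fin k → Set (Set ι)) (hD : ∀ j, IsLowerSet (D j))
    {W : Set (ι → unitInterval)} (hW : IsOpen W) (hne : W.Nonempty)
    (h : ∀ q ∈ W, sahiE (bernoulliWeight q) k (fun j => ind (D j)) = 0) : SuppZeroFlag k D :=
  (sahiE_ind_lower_identically_zero_iff D hD).1 fun p _ => sahiE_eq_zero_of_isOpen k _ hW hne h p

/-- Decreasing events: `E_k` vanishes on some nonempty open set of parameters iff `D ∈ Z_k`. [this work] -/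
theorem sahiE_ind_lower_eq_zero_on_open_iff {k : ℕ} (D : Fin k → Set (Set ι)) (hD : ∀ j, IsLowerSet (D j)) :
    (∃ W : Set (ι → unitInterval), IsOpen W ∧ W.Nonempty ∧ ∀ q ∈ W, sahiE (bernoulliWeight q) k (fun j => ind (D j)) = 0) ↔
      SuppZeroFlag k D :=
  ⟨fun ⟨_, hW, hne, h⟩ => suppZeroFlag_lower_of_eq_zero_on_open D hD hW hne h,
    fun hZ => ⟨Set.univ, isOpen_univ, ⟨fun _ => 0, Set.mem_univ _⟩, fun q _ => masterFamilyEqIff_mpr k ι q D hZ⟩⟩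

/-- **The all-order step for decreasing families**: a decreasing family with a `Z_{n+2}` deletion has `E_{n+3} ≥ 0` everywhere and, in the
open cube, `E_{n+3} = 0 ↔ Z_{n+3}` (transfer of `masterFamily_step_all`). [this work] -/
theorem masterFamily_step_all_lower (p : ι → unitInterval) {n : ℕ} (D : Fin (n + 3) → Set (Set ι)) (hD : ∀ j, IsLowerSet (D j))
    (m : Fin (n + 3)) (hZ : SuppZeroFlag (n + 2) (fun j => D (m.succAbove j))) :
    0 ≤ sahiE (bernoulliWeight p) (n + 3) (fun j => ind (D j)) ∧
      ((∀ e, (p e : ℝ) ∈ Set.Ioo (0 : ℝ) 1) →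
        (sahiE (bernoulliWeight p) (n + 3) (fun j => ind (D j)) = 0 ↔ SuppZeroFlag (n + 3) D)) := by
  have hU : ∀ j, IsUpperSet (compl ⁻¹' D j) := fun j => isUpperSet_preimage_compl (hD j)
  have hZ' : SuppZeroFlag (n + 2) (fun j => compl ⁻¹' D (m.succAbove j)) :=
    (suppZeroFlag_preimage_compl_iff (n + 2) (fun j => D (m.succAbove j))).2 hZ
  have h := masterFamily_step_all (fun e => σ (p e)) (fun j => compl ⁻¹' D j) hU m hZ'
  rw [← sahiE_ind_eq_sahiE_ind_preimage_compl, suppZeroFlag_preimage_compl_iff] at h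
  exact ⟨h.1, fun hp => h.2 ((symm_mem_Ioo_iff p).2 hp)⟩

/-! ### Generic parameters for decreasing families -/

/-- Each decreasing per-family good set is open. [this work] -/
theorem isOpen_goodFor_lower (k : ℕ) (D : Fin k → Set (Set ι)) :
    IsOpen {p : ι → unitInterval | (∀ j, IsLowerSet (D j)) →
      (sahiE (bernoulliWeight p) k (fun j => ind (D j)) = 0 ↔ SuppZeroFlag k D)} := by
  by_cases h : (∀ j, IsLowerSet (D j)) ∧ ¬ SuppZeroFlag k D
  · have e : {p : ι → unitInterval | (∀ j, IsLowerSet (D j)) →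
        (sahiE (bernoulliWeight p) k (fun j => ind (D j)) = 0 ↔ SuppZeroFlag k D)} =
        {p | sahiE (bernoulliWeight p) k (fun j => ind (D j)) ≠ 0} := by
      ext p
      simp only [Set.mem_setOf_eq]
      exact ⟨fun hp h0 => h.2 ((hp h.1).1 h0), fun hp _ => ⟨fun h0 => absurd h0 hp, fun hZ => absurd hZ h.2⟩⟩
    rw [e]
    exact isOpen_ne_fun (continuous_sahiE_bernoulliWeight k _) continuous_const
  · have e : {p : ι → unitInterval | (∀ j, IsLowerSet (D j)) →
        (sahiE (bernoulliWeight p) k (fun j => ind (D j)) = 0 ↔ SuppZeroFlag k D)} = Set.univ := by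
      ext p
      simp only [Set.mem_setOf_eq, Set.mem_univ, iff_true]
      intro hD
      have hZ : SuppZeroFlag k D := by by_contra hZ; exact h ⟨hD, hZ⟩
      exact ⟨fun _ => hZ, fun _ => masterFamilyEqIff_mpr k ι p D hZ⟩
    rw [e]; exact isOpen_univ

/-- Each decreasing per-family good set is dense. [this work] -/
theorem dense_goodFor_lower (k : ℕ) (D : Fin k → Set (Set ι)) :
    Dense {p : ι → unitInterval | (∀ j, IsLowerSet (D j)) →
      (sahiE (bernoulliWeight p) k (fun j => ind (D j)) = 0 ↔ SuppZeroFlag k D)} := by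
  refine dense_iff_inter_open.2 fun W hW hne => ?_
  by_contra hempty
  rw [Set.not_nonempty_iff_eq_empty] at hempty
  have hall : ∀ q ∈ W, ¬ ((∀ j, IsLowerSet (D j)) →
      (sahiE (bernoulliWeight q) k (fun j => ind (D j)) = 0 ↔ SuppZeroFlag k D)) := by
    intro q hq hgood
    have : q ∈ W ∩ {p : ι → unitInterval | (∀ j, IsLowerSet (D j)) →
        (sahiE (bernoulliWeight p) k (fun j => ind (D j)) = 0 ↔ SuppZeroFlag k D)} := ⟨hq, hgood⟩
    rw [hempty] at this
    exact this
  obtain ⟨q₀, hq₀⟩ := hne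
  have hD : ∀ j, IsLowerSet (D j) := by
    by_contra hD; exact hall q₀ hq₀ fun h => absurd h hD
  have hZ : ¬ SuppZeroFlag k D := fun hZ => hall q₀ hq₀ fun _ => ⟨fun _ => hZ, fun _ => masterFamilyEqIff_mpr k ι q₀ D hZ⟩
  have hzero : ∀ q ∈ W, sahiE (bernoulliWeight q) k (fun j => ind (D j)) = 0 := by
    intro q hq
    by_contra hq0
    exact hall q hq fun _ => ⟨fun h0 => absurd h0 hq0, fun hZ' => absurd hZ' hZ⟩
  exact hZ (suppZeroFlag_lower_of_eq_zero_on_open D hD hW ⟨q₀, hq₀⟩ hzero)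

/-- **The decreasing good parameter set is open.** [this work] -/
theorem isOpen_goodParams_lower (ι : Type) [Fintype ι] (k : ℕ) :
    IsOpen {p : ι → unitInterval | ∀ D : Fin k → Set (Set ι), (∀ j, IsLowerSet (D j)) →
      (sahiE (bernoulliWeight p) k (fun j => ind (D j)) = 0 ↔ SuppZeroFlag k D)} := by
  have e : {p : ι → unitInterval | ∀ D : Fin k → Set (Set ι), (∀ j, IsLowerSet (D j)) →
      (sahiE (bernoulliWeight p) k (fun j => ind (D j)) = 0 ↔ SuppZeroFlag k D)} =
      ⋂ D : Fin k → Set (Set ι), {p : ι → unitInterval | (∀ j, IsLowerSet (D j)) →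
        (sahiE (bernoulliWeight p) k (fun j => ind (D j)) = 0 ↔ SuppZeroFlag k D)} := by
    ext p; simp only [Set.mem_setOf_eq, Set.mem_iInter]
  rw [e]
  exact isOpen_iInter_of_finite fun D => isOpen_goodFor_lower k D

/-- **The decreasing good parameter set is dense**: at a dense open set of parameter vectors, `E_k(μ_p; 1_D) = 0 ↔ D ∈ Z_k` for EVERY
decreasing `k`-family `D` on `ι` simultaneously. [this work] -/
theorem dense_goodParams_lower (ι : Type) [Fintype ι] (k : ℕ) :
    Dense {p : ι → unitInterval | ∀ D : Fin k → Set (Set ι), (∀ j, IsLowerSet (D j)) →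
      (sahiE (bernoulliWeight p) k (fun j => ind (D j)) = 0 ↔ SuppZeroFlag k D)} := by
  set G : (Fin k → Set (Set ι)) → Set (ι → unitInterval) := fun D =>
    {p : ι → unitInterval | (∀ j, IsLowerSet (D j)) →
      (sahiE (bernoulliWeight p) k (fun j => ind (D j)) = 0 ↔ SuppZeroFlag k D)} with hGdef
  have key : ∀ 𝓕 : Finset (Fin k → Set (Set ι)), Dense (⋂ D ∈ 𝓕, G D) := by
    intro 𝓕
    induction 𝓕 using Finset.induction_on with
    | empty => simp [dense_univ]
    | insert V 𝓕 _ ih =>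
      rw [Finset.set_biInter_insert]
      exact (dense_goodFor_lower k V).inter_of_isOpen_left ih (isOpen_goodFor_lower k V)
  have e : {p : ι → unitInterval | ∀ D : Fin k → Set (Set ι), (∀ j, IsLowerSet (D j)) →
      (sahiE (bernoulliWeight p) k (fun j => ind (D j)) = 0 ↔ SuppZeroFlag k D)} =
      ⋂ D ∈ (univ : Finset (Fin k → Set (Set ι))), G D := by
    ext p; simp [hGdef]
  rw [e]; exact key univ

end Pointwise

/-! ### The graph form: group separations -/

namespace Pointwise

open Literature.Probability.Percolation

variable {V : Type} [Fintype V]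

/-- **(EQI-k) for group separations, every order, unconditionally**: for `k` group separations `D_j = {X_j ↮ Y_j}` of a finite graph,
`E_k(μ_w; 1_{D_0},…,1_{D_{k−1}}) = 0` for EVERY edge-weight vector `w` in the open cube iff the separations form a zero flag (`Z_k` on the
edge cube `Set (Sym2 V)`). [this work] -/
theorem sahiE_groupSep_identically_zero_iff {k : ℕ} (X Y : Fin k → Set V) :
    (∀ w : Sym2 V → unitInterval, (∀ e, (w e : ℝ) ∈ Set.Ioo (0 : ℝ) 1) →
        sahiE (bernoulliWeight w) k
          (fun j => ind {ω : BondConfig V | ∀ x ∈ X j, ∀ y ∈ Y j, ¬ (openGraph ω).Reachable x y}) = 0) ↔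
      SuppZeroFlag k fun j => {ω : BondConfig V | ∀ x ∈ X j, ∀ y ∈ Y j, ¬ (openGraph ω).Reachable x y} :=
  sahiE_ind_lower_identically_zero_iff _ fun j => isLowerSet_groupSep (X j) (Y j)

/-- **Group separations: `E_k` vanishes on a nonempty OPEN set of edge-weight vectors iff the separations form a zero flag.** [this work] -/
theorem sahiE_groupSep_eq_zero_on_open_iff {k : ℕ} (X Y : Fin k → Set V) :
    (∃ W : Set (Sym2 V → unitInterval), IsOpen W ∧ W.Nonempty ∧ ∀ w ∈ W,
        sahiE (bernoulliWeight w) k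
          (fun j => ind {ω : BondConfig V | ∀ x ∈ X j, ∀ y ∈ Y j, ¬ (openGraph ω).Reachable x y}) = 0) ↔
      SuppZeroFlag k fun j => {ω : BondConfig V | ∀ x ∈ X j, ∀ y ∈ Y j, ¬ (openGraph ω).Reachable x y} :=
  sahiE_ind_lower_eq_zero_on_open_iff _ fun j => isLowerSet_groupSep (X j) (Y j)

/-- **Generic edge weights**: every nonempty open set of edge-weight vectors of a finite graph contains a vector `w` (necessarily in the open
cube) at which, for EVERY `k`-tuple of group separations, `E_k(μ_w; 1_D) = 0 ↔ D ∈ Z_k`. [this work] -/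
theorem exists_groupSep_goodWeights_of_isOpen (k : ℕ) {W : Set (Sym2 V → unitInterval)} (hW : IsOpen W) (hne : W.Nonempty) :
    ∃ w ∈ W, ∀ X Y : Fin k → Set V,
      sahiE (bernoulliWeight w) k
          (fun j => ind {ω : BondConfig V | ∀ x ∈ X j, ∀ y ∈ Y j, ¬ (openGraph ω).Reachable x y}) = 0 ↔
        SuppZeroFlag k fun j => {ω : BondConfig V | ∀ x ∈ X j, ∀ y ∈ Y j, ¬ (openGraph ω).Reachable x y} := by
  obtain ⟨w, hwW, hw⟩ := (dense_goodParams_lower (Sym2 V) k).inter_open_nonempty W hW hne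
  exact ⟨w, hwW, fun X Y => hw _ fun j => isLowerSet_groupSep (X j) (Y j)⟩

/-- **Group separations with a zero-flag deletion** (e.g. two of the separations with disjoint pivotal edge sets, at `k = 3`): `E_k ≥ 0` for
every weight vector and, for weights in the open cube, `E_k = 0 ↔` zero flag — the percolation form of the all-order step. [this work] -/
theorem sahiE_groupSep_step {n : ℕ} (w : Sym2 V → unitInterval) (X Y : Fin (n + 3) → Set V) (m : Fin (n + 3))
    (hZ : SuppZeroFlag (n + 2) fun j =>
      {ω : BondConfig V | ∀ x ∈ X (m.succAbove j), ∀ y ∈ Y (m.succAbove j), ¬ (openGraph ω).Reachable x y}) :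
    0 ≤ sahiE (bernoulliWeight w) (n + 3)
        (fun j => ind {ω : BondConfig V | ∀ x ∈ X j, ∀ y ∈ Y j, ¬ (openGraph ω).Reachable x y}) ∧
      ((∀ e, (w e : ℝ) ∈ Set.Ioo (0 : ℝ) 1) →
        (sahiE (bernoulliWeight w) (n + 3)
            (fun j => ind {ω : BondConfig V | ∀ x ∈ X j, ∀ y ∈ Y j, ¬ (openGraph ω).Reachable x y}) = 0 ↔
          SuppZeroFlag (n + 3) fun j => {ω : BondConfig V | ∀ x ∈ X j, ∀ y ∈ Y j, ¬ (openGraph ω).Reachable x y})) :=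
  masterFamily_step_all_lower w _ (fun j => isLowerSet_groupSep (X j) (Y j)) m hZ

end Pointwise

end Summit.CriticalPhenomena.PercolationContinuityZ3.Theorems
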